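import Summits.HodgeConjecture.HodgeConjecture.Theorems.VHCAbelianSchemesRoadAtiyahPushforwardCompatOfJets
import Summits.HodgeConjecture.HodgeConjecture.Theorems.VHCAbelianSchemesRoadIsogenyTwistPushforwardIso
import Summits.HodgeConjecture.HodgeConjecture.Theorems.VHCAbelianSchemesRoadIsogenyDerivedAdjointPairOfRouteK
import HarnessLib

/-!
# Road №4 (`VHCAbelianSchemesRoad`) — stub (c1At) `stub_atiyahPair` of skeleton v3.13 (crux stmt-HodgeConjecture-26512) AT THE NODE AND
# TWIST DATA OF RECORD, modulo its exact residual BY NAME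

research route conditional on HC_CM; not a corollary; Q11.4-sentence-2 already refuted in dim ≥ 3.

Seat core-w3 (director-hodge g16 R16.18 (1) ∕ R16.22: (c1At) = this seat's DERIVED half `…AtiyahPushforwardCompatOfJets` (p652793) +
core-qb's MODULE half + law (δ) over `P₀` (core-w5) ). `--supports stmt-HodgeConjecture-26512 --as helper`; closes NO stub: the registered
statement (c1At) `∀ hΩ, AtiyahClassPushforwardCompatPair isogenyDerivedAdjointPairOfRouteK (isogenyTwistPushforwardIsoFamily hΩ)`
(`Cruxes/DiagLocalOfMarkmanPinnedForall/Lines/birth.lean` v3.13 l.279) is proved here UNDER its three residual inputs, each displayed as a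
hypothesis under the decl name its owner announced — so that the tree states the EXACT residual of (c1At) at the node of record
`P₀ = isogenyDerivedAdjointPairOfRouteK` (core-w7, route K) and the twist family `α₀ = isogenyTwistPushforwardIsoFamily hΩ` (core-w6), and
the instantiation of the generic reduction `atiyahClassPushforwardCompatPair_of` at `(P₀, α₀)` is KERNEL-CHECKED now (the line card's
«why it might fail: only in the typing»). Nothing here says (c1At), law (δ), the jet ∕ `ι•` compatibilities of `α₀`, (SC), (c1), THEOREM T′,
26511 ∕ 26512 ∕ 23176, `HC_AV`, `HC_CM` or HC holds; HC_CM HELD, by name only; typed ≠ proved.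

* `atiyahPair_of_residual : (δ over P₀) → (jets over α₀) → (ι• over α₀) → ∀ hΩ, AtiyahClassPushforwardCompatPair P₀ (α₀ hΩ)` — the
  residual: (δ) `∀ A g hg, (isogenyDerivedAdjointPairOfRouteK A g hg).AdjTriangleOfSESδComp` [core-w5 ∕ core-w7, route K: mapping-cone
  description of `δ`], (jets) `∀ hΩ A g hg, TwistJetPushforwardComparison (isogenyTwistPushforwardIsoFamily hΩ A g hg)` and (ι•)
  `∀ hΩ A g hg, IotaPushforwardCompat (isogenyTwistPushforwardIsoFamily hΩ A g hg)` [core-qb's instantiation of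
  `…TwistJetPushforwardCompat` (p651635) on core-w6's `α₀`, compatibilities (W)(N)(I)]. When the three are theorems, (c1At) closes by the
  one-liner `fun hΩ => atiyahPair_of_residual ‹δ› ‹jets› ‹ι•› hΩ` under the registered name.

References: [cite: BuchweitzFlenner2003, §3 (Atiyah class of a complex) and Def. 4.1] [cite: Atiyah1957, §4 Prop. 6–7]
[cite: Weibel1994, §10.4 and Example 10.4.9] [cite: MumfordAV1970, §4 (iii) (p. 42) and §7 Thm. 4 (p. 72)].
-/

noncomputable section

open CategoryTheory CategoryTheory.Limits AlgebraicGeometry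

namespace Summit.HodgeConjecture.HodgeConjecture.Ring2.SemiregularRepresentatives

set_option linter.dupNamespace false -- the cell's namespace repeats the summit name, as in every `Ring2*` file

open Literature.AlgebraicGeometry Literature.AlgebraicGeometry.Motives Literature.AlgebraicGeometry.Motives.AbelianVariety

/-- **(c1At) modulo its exact residual, at the node and twist data of record**: the registered statement
`∀ hΩ, AtiyahClassPushforwardCompatPair isogenyDerivedAdjointPairOfRouteK (isogenyTwistPushforwardIsoFamily hΩ)` follows from (δ) the node law
`AdjTriangleOfSESδComp` for every `isogenyDerivedAdjointPairOfRouteK A g hg`, (jets) `TwistJetPushforwardComparison` and (ι•) `IotaPushforwardCompat`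
for every `isogenyTwistPushforwardIsoFamily hΩ A g hg` — the generic reduction `atiyahClassPushforwardCompatPair_of` (p652793) instantiated at
`(P₀, α₀)`. CONDITIONAL on exactly these three displayed inputs; closes no stub; HC_CM untouched.
[cite: BuchweitzFlenner2003, §3 and Def. 4.1] [cite: Weibel1994, §10.4 and Example 10.4.9] [cite: MumfordAV1970, §4 (iii) (p. 42)] -/
theorem atiyahPair_of_residual
    (hδ : ∀ (A : AbelianVariety ℂ) (g : A ⟶ A) (hg : IsIsogeny g),
      letI := HasDerivedCategory.standard A.X.left.Modules
      (isogenyDerivedAdjointPairOfRouteK A g hg).AdjTriangleOfSESδComp)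
    (hjet : ∀ (hΩ : Mumford1970_cotangentSheaf_abelianVariety_free) (A : AbelianVariety ℂ) (g : A ⟶ A) (hg : IsIsogeny g),
      TwistJetPushforwardComparison (isogenyTwistPushforwardIsoFamily hΩ A g hg))
    (hι : ∀ (hΩ : Mumford1970_cotangentSheaf_abelianVariety_free) (A : AbelianVariety ℂ) (g : A ⟶ A) (hg : IsIsogeny g),
      IotaPushforwardCompat (isogenyTwistPushforwardIsoFamily hΩ A g hg))
    (hΩ : Mumford1970_cotangentSheaf_abelianVariety_free) :
    AtiyahClassPushforwardCompatPair isogenyDerivedAdjointPairOfRouteK (isogenyTwistPushforwardIsoFamily hΩ) :=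
  atiyahClassPushforwardCompatPair_of isogenyDerivedAdjointPairOfRouteK (isogenyTwistPushforwardIsoFamily hΩ) hδ (hjet hΩ) (hι hΩ)

end Summit.HodgeConjecture.HodgeConjecture.Ring2.SemiregularRepresentatives

end
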